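/-
Copyright (c) 2026. All rights reserved.
Released under Apache 2.0 license as described in the file LICENSE.
Authors: abc-iut cell, prover seat abc-iut-f-167 (block F, gen 5).
-/
import Literature.IUT.LogVolume.UnitLogWildDepth
import HarnessLib

/-!
# Depth of the log-unit lattice along a wildly ramified extension, III: cyclotomic type — the level-two witness

Proof-only sequel (theorems, no definitions) of `UnitLogWildDepth.lean` / `UnitLogWildDepthTie.lean`.  In the tie
case `e(K) = pᵃ(p−1)` of CYCLOTOMIC type (residue field `𝔽_p`, `ϖ^{e}/p ≡ −1`; e.g. `K ⊇ ℚ_p(ζ_p)` totally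
ramified) every level-one logarithm `L(1 − wϖ)` cancels at its two tied dominant terms, so the log-unit lattice of
`K` is DEEPER than the generic bound `‖ϖ‖^{pᵃ − e·a}`; when it is as deep as its level-two part —
`‖z‖ ≤ ‖ϖ‖^{2pᵃ − e·a}` for every `z ∈ log_p(𝒪_K^×)`, e.g. `log_p(𝒪_K^×) ⊆ 𝔪_K²` for `K = ℚ_p(ζ_p)` — the
level-`2c` element upstairs is a depth witness.  PROVED (`p` odd):

* **`exists_mem_logUnits_pow_mul_norm_le_of_level_two`** — `e(K) = pᵃ(p−1)`, `e(K') = e(K)·c·pᵗ` (`c ≥ 1`), the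
  level-two bound on `log_p(𝒪_K^×)` ⇒ for every `z ∈ log_p(𝒪_K^×)` the log-unit `z' = log_p(1 − ϖ'^{2c})` of `K'`
  has **`pᵗ·‖z‖ ≤ ‖z'‖`**: the exponents `2c·n − e'·v_p(n)` have the STRICT turning point `a + t` (`2pᵇ < p^{a+t}`
  below it as `p ≥ 3`, `1 < 2` at it), so `‖z'‖ = ‖ϖ'‖^{2c·p^{a+t} − e'(a+t)} = pᵗ·‖ϖ‖^{2pᵃ − e·a}` exactly.

Classical (Neukirch, *Algebraic Number Theory* II (5.5)); nothing here is disputed mathematics; no IUT statement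
is asserted; nothing bears on [IUTchIII] Cor. 3.12.  Consumer: `TensorPacketSemilinearTransport(Wild).lean`
(item (X) of the G1-Θ memo at tie factors of cyclotomic type, with the level-two bound supplied per field).
-/

noncomputable section

open Metric Set

namespace Literature.IUT.LogVolume

namespace RamificationCriterion

open Literature.NumberTheory.GaloisRepresentations.Ultrametric

variable (p : ℕ) [hp : Fact p.Prime]
variable {K : Type*} [NontriviallyNormedField K] [instK : NormedAlgebra ℚ_[p] K] [IsUltrametricDist K]
  [ProperSpace K]
variable {K' : Type*} [NontriviallyNormedField K'] [instK' : NormedAlgebra ℚ_[p] K'] [IsUltrametricDist K']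
  [ProperSpace K']

/-! ### The level-two witness -/

/-- **Level-two witness (tie case, `p` odd)**: if `e(K) = pᵃ(p−1)`, `e(K') = e(K)·c·pᵗ` (`c ≥ 1`) and the
log-unit lattice of `K` is as deep as its level-two part — `‖z‖ ≤ ‖ϖ‖^{2pᵃ − e·a}` for every `z ∈ log_p(𝒪_K^×)`
(e.g. `K = ℚ_p(ζ_p)`: `log_p(𝒪_K^×) ⊆ 𝔪_K²`) — then for every such `z` the log-unit `z' = log_p(1 − ϖ'^{2c})` of
`K'` has **`pᵗ·‖z‖ ≤ ‖z'‖`**: the exponents `2c·n − e'·v_p(n)` have the STRICT turning point `a + t`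
(`2pᵇ < p^{a+t}` below it since `p ≥ 3`, `1 < 2` at it), so `‖z'‖ = ‖ϖ'‖^{2c·p^{a+t} − e'(a+t)} = pᵗ·‖ϖ‖^{2pᵃ − e a}`.
This is the witness at fields of cyclotomic type, where every level-one logarithm cancels.
[cite: NeukirchANT1999, Ch. II (5.5)] [cite: Mochizuki2012, IUTchIV Prop. 1.2 (i) p. 10] -/
theorem exists_mem_logUnits_pow_mul_norm_le_of_level_two (hp2 : p ≠ 2) {a c t : ℕ}
    (hea : absRamificationIdx p K = p ^ a * (p - 1)) (hc : c ≠ 0)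
    (he' : absRamificationIdx p K' = absRamificationIdx p K * (c * p ^ t))
    {ϖ : Kˣ} (hϖ : IsUniformizer ϖ)
    (hK : ∀ z ∈ logUnits K, ‖z‖ ≤ ‖(ϖ : K)‖ ^ ((2 : ℤ) * (p : ℤ) ^ a - (absRamificationIdx p K : ℤ) * (a : ℤ)))
    {z : K} (hz : z ∈ logUnits K) :
    ∃ z' ∈ logUnits K', (p : ℝ) ^ t * ‖z‖ ≤ ‖z'‖ := by
  classical
  obtain ⟨ϖ', hϖ'⟩ := exists_isUniformizer (F := K')
  set e : ℕ := absRamificationIdx p K with he_def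
  set e' : ℕ := absRamificationIdx p K' with he'_def
  have hp0 : (0 : ℝ) < p := by exact_mod_cast hp.out.pos
  have hp3 : (3 : ℤ) ≤ (p : ℤ) := by
    have h2 := hp.out.two_le
    have : p ≠ 2 := hp2
    omega
  have hP : (2 : ℤ) ≤ (p : ℤ) := by linarith
  have hρ0 : 0 < ‖(ϖ' : K')‖ := norm_units_pos ϖ'
  have hc1 : (1 : ℤ) ≤ (c : ℤ) := by exact_mod_cast Nat.one_le_iff_ne_zero.mpr hc
  have h2c1 : (1 : ℤ) ≤ 2 * (c : ℤ) := by linarith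
  -- `e' = c p^{a+t} (p − 1)`
  have he'Z : (e' : ℤ) = (c : ℤ) * (p : ℤ) ^ (a + t) * ((p : ℤ) - 1) := by
    have h1 : ((p - 1 : ℕ) : ℤ) = (p : ℤ) - 1 := by rw [Nat.cast_sub hp.out.one_le]; push_cast; ring
    have h2 : (e' : ℤ) = ((p ^ a * (p - 1) * (c * p ^ t) : ℕ) : ℤ) := by
      have h3 : e' = p ^ a * (p - 1) * (c * p ^ t) := by rw [he', hea]
      exact_mod_cast h3
    rw [h2, Nat.cast_mul, Nat.cast_mul, Nat.cast_mul, Nat.cast_pow, Nat.cast_pow, h1]; ring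
  -- the witness `y = 1 − ϖ'^{2c}`, level `2c`
  set y : K' := 1 - (ϖ' : K') ^ (2 * c) with hy_def
  have hy : ‖1 - y‖ = ‖(ϖ' : K')‖ ^ ((2 * c : ℕ) : ℤ) := by
    rw [hy_def, sub_sub_cancel, norm_pow, zpow_natCast]
  have h2c0 : 2 * c ≠ 0 := by omega
  have hyP : IsPrincipal y := by
    rw [isPrincipal_iff, hy, zpow_natCast]
    exact pow_lt_one₀ (norm_nonneg _) hϖ'.1 h2c0
  -- strict turning point `a + t` for `h(b) = 2c p^b − e' b`
  have hlo' : ∀ b < a + t, ((2 * c : ℕ) : ℤ) * (p : ℤ) ^ b * ((p : ℤ) - 1) < e' := by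
    intro b hb
    rw [he'Z]
    obtain ⟨d, hd⟩ := Nat.exists_eq_add_of_lt hb
    have hpow : (p : ℤ) ^ (a + t) = (p : ℤ) ^ b * (p : ℤ) * (p : ℤ) ^ d := by
      rw [hd, show b + d + 1 = b + 1 + d by ring, pow_add, pow_succ]
    rw [hpow]
    have hpb : (0 : ℤ) < (p : ℤ) ^ b := by positivity
    have hpd : (1 : ℤ) ≤ (p : ℤ) ^ d := one_le_pow₀ (by linarith)
    have h3a : (p : ℤ) ^ b * 3 * 1 ≤ (p : ℤ) ^ b * (p : ℤ) * (p : ℤ) ^ d :=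
      mul_le_mul (mul_le_mul_of_nonneg_left hp3 hpb.le) hpd (by norm_num) (by positivity)
    have h3 : (2 : ℤ) * (p : ℤ) ^ b < (p : ℤ) ^ b * (p : ℤ) * (p : ℤ) ^ d := by linarith
    have hcp : (0 : ℤ) < (c : ℤ) * ((p : ℤ) - 1) := mul_pos (by linarith) (by linarith)
    have h4 := mul_lt_mul_of_pos_left h3 hcp
    push_cast
    nlinarith
  have hhi' : (e' : ℤ) < ((2 * c : ℕ) : ℤ) * (p : ℤ) ^ (a + t) * ((p : ℤ) - 1) := by
    rw [he'Z]; push_cast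
    have hpat : (0 : ℤ) < (p : ℤ) ^ (a + t) := by positivity
    have : (0 : ℤ) < (c : ℤ) * (p : ℤ) ^ (a + t) * ((p : ℤ) - 1) :=
      mul_pos (mul_pos (by linarith) hpat) (by linarith)
    nlinarith
  have hstrict : ∀ b : ℕ, b ≠ a + t → ((2 * c : ℕ) : ℤ) * (p : ℤ) ^ (a + t) - e' * ((a + t : ℕ) : ℤ) + 1 ≤
      ((2 * c : ℕ) : ℤ) * (p : ℤ) ^ b - e' * (b : ℤ) :=
    fun b hb ↦ exponent_min_strict (a₀ := a + t) (by push_cast; exact h2c1) hP hlo' hhi' hb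
  obtain ⟨n₀, hn₀⟩ : ∃ n₀ : ℕ, n₀ + 1 = p ^ (a + t) :=
    ⟨p ^ (a + t) - 1, Nat.sub_add_cancel (Nat.one_le_pow _ _ hp.out.pos)⟩
  have hN₀ : ((2 * c : ℕ) : ℤ) * ((n₀ + 1 : ℕ) : ℤ) - (e' : ℤ) * (padicValNat p (n₀ + 1) : ℤ)
      = ((2 * c : ℕ) : ℤ) * (p : ℤ) ^ (a + t) - e' * ((a + t : ℕ) : ℤ) := by
    rw [hn₀, padicValNat.prime_pow]; push_cast; ring
  have hdom : ∀ n : ℕ, n ≠ n₀ → ((2 * c : ℕ) : ℤ) * (p : ℤ) ^ (a + t) - e' * ((a + t : ℕ) : ℤ) + 1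
      ≤ ((2 * c : ℕ) : ℤ) * ((n + 1 : ℕ) : ℤ) - (e' : ℤ) * (padicValNat p (n + 1) : ℤ) := by
    intro n hn
    obtain ⟨b, hb, hb'⟩ := exists_exponent_le_index (p := p) (s := ((2 * c : ℕ) : ℤ))
      (by push_cast; exact h2c1) e' (Nat.succ_ne_zero n)
    by_cases hbb : b = a + t
    · have hne : n + 1 ≠ p ^ b := by rw [hbb, ← hn₀]; intro h; exact hn (by omega)
      have := hb' hne
      rw [hbb] at this
      exact this
    · exact (hstrict b hbb).trans hb
  have hnorm := norm_logSeries_eq_zpow_of_dominant p hϖ' hyP hy n₀ hN₀ hdom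
  refine ⟨unitLog y, unitLog_mem_logUnits hyP.norm_eq_one, ?_⟩
  rw [unitLog_of_isPrincipal p hyP, hnorm, norm_unif_zpow_eq_rpow p hϖ']
  have hz' := hK z hz
  rw [norm_unif_zpow_eq_rpow p hϖ] at hz'
  have heR : (e : ℝ) ≠ 0 := by exact_mod_cast (absRamificationIdx_pos p K).ne'
  have hcR : (c : ℝ) ≠ 0 := by exact_mod_cast hc
  have hptR : (p : ℝ) ^ t ≠ 0 := pow_ne_zero _ hp0.ne'
  have he'R : (e' : ℝ) = e * (c * (p : ℝ) ^ t) := by exact_mod_cast he'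
  have hexp : (t : ℝ) + -(((2 : ℤ) * (p : ℤ) ^ a - (e : ℤ) * (a : ℤ) : ℤ) : ℝ) / (e : ℝ) =
      -((((2 * c : ℕ) : ℤ) * (p : ℤ) ^ (a + t) - (e' : ℤ) * ((a + t : ℕ) : ℤ) : ℤ) : ℝ) / (e' : ℝ) := by
    push_cast
    rw [he'R]
    field_simp
    ring
  calc (p : ℝ) ^ t * ‖z‖
      ≤ (p : ℝ) ^ t * (p : ℝ) ^ (-(((2 : ℤ) * (p : ℤ) ^ a - (e : ℤ) * (a : ℤ) : ℤ) : ℝ) / (e : ℝ)) :=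
        mul_le_mul_of_nonneg_left hz' (pow_pos hp0 _).le
    _ = (p : ℝ) ^ ((t : ℝ) + -(((2 : ℤ) * (p : ℤ) ^ a - (e : ℤ) * (a : ℤ) : ℤ) : ℝ) / (e : ℝ)) := by
        rw [Real.rpow_add hp0, Real.rpow_natCast]
    _ = (p : ℝ) ^ (-((((2 * c : ℕ) : ℤ) * (p : ℤ) ^ (a + t) - (e' : ℤ) * ((a + t : ℕ) : ℤ) : ℤ) : ℝ) / (e' : ℝ)) := by
        rw [hexp]


end RamificationCriterion

end Literature.IUT.LogVolume

end
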